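import Literature.NumberTheory.Automorphic.WhittakerTowerDerivative
import Literature.NumberTheory.Automorphic.WhittakerTowerCoeff
import Literature.NumberTheory.Automorphic.CuspFormsRapidDecayUnipotentArch
import Literature.NumberTheory.Automorphic.AdelicAdditiveCharacterDuality
import HarnessLib

/-!
# Whittaker functions along archimedean unipotent lines: `W(g exp(sX')) = ψ_∞(s) W(g)` and the
# resulting bound `|W(g)| · (2π |Tr b|)^m ≤ ‖X'^m φ‖_∞`

Topic `NumberTheory/Automorphic`; namespace `Literature.NumberTheory.Automorphic`. For a left
`GL_n(K)`-invariant function `φ` on `GL_n(𝔸_K)` with global Whittaker function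
`W_φ = Φ_0 = whittakerDepth 0 φ` (Tate's character; `WhittakerTower`), a block direction `b`
(`ArchBlockSpace n k K`, `0 < k < n`) and `g ∈ GL_n(𝔸_K)`, Moeglin–Waldspurger's twisted direction
`X' = Ad(g_∞⁻¹)(blockMatrixOf b)` (`twistedBlockDir`, from `CuspFormsRapidDecayUnipotentArch`)
satisfies `g · (exp(sX'), 1) = (1 + s b) · g` with `1 + s b ∈ N_n(𝔸_K)`, so that by the
`(N, ψ)`-equivariance of `W_φ`

  `W_φ(g · (exp(sX'), 1)) = ψ(1 + s b) · W_φ(g) = exp(-2πi s Tr(b_{k-1,k})) · W_φ(g)`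

(`whittakerDepth_zero_mul_expMem_twistedBlockDir`, `unipotentCharFrom_one_archUnipotent`; here
`Tr = mixedTrace K : K_∞ → ℝ`). Differentiating `m` times at `s = 0` (the left-hand side through the
tower, `iteratedDeriv_whittakerDepth_flow` of `WhittakerTowerDerivative`) gives the basic inequality
behind every estimate of Whittaker functions by derivatives of the form:

* `norm_whittakerDepth_zero_mul_pow_le` — **`‖W_φ(g)‖ · (2π |Tr(b_{k-1,k})|)^m ≤ M`** whenever
  `‖(X'^m φ)(z)‖ ≤ M` for all `z` (for `φ` whose iterated Lie derivatives are archimedean-smooth and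
  continuous).

This is the integration by parts "`(2πi λ)^h W = W_{X'^h φ}`" of Moeglin–Waldspurger (1995),
I.2.10–I.2.11, and of the convergence half of the Fourier expansion of cusp forms (Cogdell (2004),
Thm. 1.1: "convergence is absolute and uniform on compact subsets"). Everything here is proved; no
definitions are introduced.

## References

* C. Moeglin, J.-L. Waldspurger, *Spectral decomposition and Eisenstein series* (1995), I.2.10,
  I.2.11 [MoeglinWaldspurger1995].
* J. W. Cogdell, *Analytic theory of L-functions for GL_n*, in *An Introduction to the Langlands
  Program* (2004), §1.1, Thm. 1.1 [CogdellAnalyticTheory2004].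
-/

noncomputable section

open MeasureTheory NumberField NumberField.mixedEmbedding IsDedekindDomain Matrix Set Filter Topology Real
open scoped MatrixGroups ComplexConjugate Classical

namespace Literature.NumberTheory.Automorphic

variable {n k : ℕ} {K : Type} [Field K] [NumberField K]

/-! ### The character along an archimedean block line -/

/-- Block unipotents `1 + Y`, `Y ∈ 𝔫_k`, are upper unitriangular (local copy of
`unipotentOfBlock_mem_upperUnitriangular` of `GLnCuspidalSiegelDifferences`, not imported here).
[folklore] -/
private theorem unipotentOfBlock_mem_upperUnitriangular' {R : Type*} [CommRing R]
    (Y : blockNilpotent n k R) :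
    unipotentOfBlock n k R (Multiplicative.ofAdd Y) ∈ upperUnitriangular (Fin n) R := by
  rw [mem_upperUnitriangular_iff, coe_unipotentOfBlock]
  refine ⟨fun i j hji => ?_, fun i => ?_⟩
  · have hji' : j < i := hji
    have hY : (Y : Matrix (Fin n) (Fin n) R) i j = 0 :=
      apply_eq_zero_of_mem_blockNilpotent Y.2 fun h => by
        have h1 : (i : ℕ) < (j : ℕ) := lt_of_lt_of_le h.1 h.2
        exact absurd h1 (not_lt.2 (Fin.le_def.1 hji'.le))
    change (1 : Matrix (Fin n) (Fin n) R) i j + (Y : Matrix (Fin n) (Fin n) R) i j = 0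
    rw [hY, add_zero, Matrix.one_apply_ne (ne_of_gt hji')]
  · have hY : (Y : Matrix (Fin n) (Fin n) R) i i = 0 :=
      apply_eq_zero_of_mem_blockNilpotent Y.2 fun h => absurd (lt_of_lt_of_le h.1 h.2) (lt_irrefl _)
    change (1 : Matrix (Fin n) (Fin n) R) i i + (Y : Matrix (Fin n) (Fin n) R) i i = 1
    rw [hY, add_zero, Matrix.one_apply_eq]

/-- **Archimedean block unipotents lie in `N_n(𝔸_K) = U_{[1,n-1]}(𝔸_K)`.** [folklore] -/
theorem archUnipotent_mem_adelicColRange (e : ArchBlockSpace n k K) :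
    archUnipotent n k K e ∈ adelicColRange n K 1 (n - 1) := by
  change archUnipotent n k K e ∈ unipotentColRange n (AdeleRing (𝓞 K) K) 1 (n - 1)
  rw [unipotentColRange_one_eq_upperUnitriangular]
  exact unipotentOfBlock_mem_upperUnitriangular' _

/-- The distinguished position `(k-1, k)` of the block `𝔫_k` (`0 < k < n`): the only superdiagonal
entry of the block. [folklore] -/
theorem superdiag_mem_blockPos (hk0 : 0 < k) (hkn : k < n) :
    (((⟨k - 1, by omega⟩ : Fin n), (⟨k, hkn⟩ : Fin n)).1 : ℕ) < k ∧
      k ≤ (((⟨k - 1, by omega⟩ : Fin n), (⟨k, hkn⟩ : Fin n)).2 : ℕ) := by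
  simp only
  omega

/-- **The superdiagonal sum of an archimedean block unipotent** `1 + e` is its entry at `(k-1, k)`:
the archimedean adele `((e_{k-1,k})_{K_∞}, 0)`. [folklore] -/
theorem superdiagSumFrom_one_archUnipotent (hk0 : 0 < k) (hkn : k < n) (e : ArchBlockSpace n k K) :
    superdiagSumFrom 1 ((archUnipotent n k K e : GL (Fin n) (AdeleRing (𝓞 K) K)) :
        Matrix (Fin n) (Fin n) (AdeleRing (𝓞 K) K)) =
      infiniteAdeleInl K ((InfiniteAdeleRing.ringEquiv_mixedSpace K).symm
        (e ⟨((⟨k - 1, by omega⟩ : Fin n), (⟨k, hkn⟩ : Fin n)), superdiag_mem_blockPos hk0 hkn⟩)) := by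
  classical
  have hM : ((archUnipotent n k K e : GL (Fin n) (AdeleRing (𝓞 K) K)) :
      Matrix (Fin n) (Fin n) (AdeleRing (𝓞 K) K)) =
        1 + ((archBlock n k K e : blockNilpotent n k (AdeleRing (𝓞 K) K)) :
          Matrix (Fin n) (Fin n) (AdeleRing (𝓞 K) K)) := by
    rw [archUnipotent_def, glUnipotent_apply, coe_unipotentOfBlock, toAdd_ofAdd]
  rw [hM]
  unfold superdiagSumFrom
  rw [Finset.sum_eq_single (⟨k, hkn⟩ : Fin n)]
  · rw [dif_pos ⟨le_trans hk0 le_rfl, hk0⟩, Matrix.add_apply, Matrix.one_apply_ne (fun h => by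
      have := congrArg Fin.val h; simp at this; omega), zero_add]
    refine Prod.ext ?_ ?_
    · rw [fst_archBlock_apply, blockMatrixOf_apply_of_mem e (by simp; omega)]
      rfl
    · rw [snd_archBlock_apply]; rfl
  · intro j _ hj
    by_cases h : 1 ≤ (j : ℕ) ∧ 0 < (j : ℕ)
    · rw [dif_pos h, Matrix.add_apply, Matrix.one_apply_ne (fun h' => by
        have := congrArg Fin.val h'; simp at this; omega), zero_add]
      have hjk : (j : ℕ) ≠ k := fun h' => hj (Fin.ext h')
      refine Prod.ext ?_ ?_
      · rw [fst_archBlock_apply, blockMatrixOf_apply_of_not e (fun h' => by simp at h'; omega), map_zero]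
        rfl
      · rw [snd_archBlock_apply]; rfl
    · rw [dif_neg h]
  · intro h; exact absurd (Finset.mem_univ _) h

/-- An adele with vanishing finite part is finite-integral (local copy). [folklore] -/
private theorem isFiniteIntegral_infiniteAdeleInl' (y : InfiniteAdeleRing K) :
    IsFiniteIntegral K (infiniteAdeleInl K y) :=
  fun v => isFiniteIntegral_zero K v

/-- **The generic character on an archimedean block unipotent**:
`ψ_N(1 + e) = exp(-2πi · Tr(e_{k-1,k}))`, `Tr = mixedTrace K : K_∞ → ℝ` (Tate's character is
`exp(-2πi Tr_{K_∞/ℝ}(x_∞))` on finite-integral adeles). [cite: CasselsFrohlichANT1967, Ch. XV (Tate), §2.2] -/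
theorem unipotentCharFrom_one_archUnipotent (hk0 : 0 < k) (hkn : k < n) (e : ArchBlockSpace n k K) :
    ((unipotentCharFrom (K := K) 1 (archUnipotent n k K e) : Circle) : ℂ) =
      Complex.exp (((-(2 * π * mixedTrace K
        (e ⟨((⟨k - 1, by omega⟩ : Fin n), (⟨k, hkn⟩ : Fin n)), superdiag_mem_blockPos hk0 hkn⟩)) : ℝ) : ℂ) *
          Complex.I) := by
  rw [unipotentCharFrom_apply, superdiagSumFrom_one_archUnipotent hk0 hkn,
    adeleAddChar_apply_of_isFiniteIntegral K (isFiniteIntegral_infiniteAdeleInl' _)]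
  change ((AddCircle.toCircle (-((infiniteAdeleTrace K ((InfiniteAdeleRing.ringEquiv_mixedSpace K).symm _) : ℝ) :
    AddCircle (1 : ℝ))) : Circle) : ℂ) = _
  rw [← AddCircle.coe_neg, AddCircle.toCircle_apply_mk, Circle.coe_exp, div_one,
    ← mixedTrace_ringEquiv_mixedSpace, RingEquiv.apply_symm_apply]
  congr 1
  push_cast
  ring

/-! ### Equivariance of the Whittaker function along the twisted flow -/

section Flow

variable [MeasurableSpace (GL (Fin n) (AdeleRing (𝓞 K) K))] [BorelSpace (GL (Fin n) (AdeleRing (𝓞 K) K))]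

/-- **`W_φ(g · (exp(sX'), 1)) = ψ_N(1 + s b) · W_φ(g)`** for `X' = twistedBlockDir g b` and `φ` left
`GL_n(K)`-invariant: `g · (exp(sX'), 1) = (1 + s b) · g` (`inv_mul_archUnipotent_smul_mul`) and
`1 + s b ∈ N_n(𝔸_K)` (`(N, ψ)`-equivariance `whittakerDepth_colRange_mul`). Moeglin–Waldspurger
(1995), I.2.10: `exp(∑ x_ℓ X_{iℓ}) a g exp(x X')`. [cite: MoeglinWaldspurger1995, I.2.10] -/
theorem whittakerDepth_zero_mul_expMem_twistedBlockDir {φ : GL (Fin n) (AdeleRing (𝓞 K) K) → ℂ}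
    (hφK : ∀ (γ₀ : GL (Fin n) K) (x : GL (Fin n) (AdeleRing (𝓞 K) K)),
      φ (Matrix.GeneralLinearGroup.map (algebraMap K (AdeleRing (𝓞 K) K)) γ₀ * x) = φ x)
    (hk0 : 0 < k) (hkn : k < n) (g : GL (Fin n) (AdeleRing (𝓞 K) K)) (b : ArchBlockSpace n k K)
    (t : ℝ) :
    whittakerDepth 0 φ (g * glArch n K ((archGroupGL n K).expMem (t • lieOf (twistedBlockDir n k K g b)))) =
      ((unipotentCharFrom (K := K) 1 (archUnipotent n k K (t • b)) : Circle) : ℂ) *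
        whittakerDepth 0 φ g := by
  rw [← inv_mul_archUnipotent_smul_mul]
  have e1 : g * (g⁻¹ * archUnipotent n k K (t • b) * g) = archUnipotent n k K (t • b) * g := by
    simp only [mul_assoc, mul_inv_cancel_left]
  rw [e1]
  exact whittakerDepth_colRange_mul hφK (d := 0) (by omega) (archUnipotent_mem_adelicColRange _) g

/-- The same with the character made explicit:
`W_φ(g · (exp(sX'), 1)) = exp(-2πi s · Tr(b_{k-1,k})) · W_φ(g)`. [cite: MoeglinWaldspurger1995, I.2.10] -/
theorem whittakerDepth_zero_mul_expMem_twistedBlockDir_eq_exp {φ : GL (Fin n) (AdeleRing (𝓞 K) K) → ℂ}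
    (hφK : ∀ (γ₀ : GL (Fin n) K) (x : GL (Fin n) (AdeleRing (𝓞 K) K)),
      φ (Matrix.GeneralLinearGroup.map (algebraMap K (AdeleRing (𝓞 K) K)) γ₀ * x) = φ x)
    (hk0 : 0 < k) (hkn : k < n) (g : GL (Fin n) (AdeleRing (𝓞 K) K)) (b : ArchBlockSpace n k K)
    (t : ℝ) :
    whittakerDepth 0 φ (g * glArch n K ((archGroupGL n K).expMem (t • lieOf (twistedBlockDir n k K g b)))) =
      Complex.exp ((((-(2 * π * mixedTrace K
        (b ⟨((⟨k - 1, by omega⟩ : Fin n), (⟨k, hkn⟩ : Fin n)), superdiag_mem_blockPos hk0 hkn⟩))) : ℝ) : ℂ) *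
          (t : ℂ) * Complex.I) * whittakerDepth 0 φ g := by
  rw [whittakerDepth_zero_mul_expMem_twistedBlockDir hφK hk0 hkn g b t,
    unipotentCharFrom_one_archUnipotent hk0 hkn]
  congr 2
  rw [Pi.smul_apply, map_smul, smul_eq_mul]
  push_cast
  ring

end Flow

/-! ### The scalar identity and the basic inequality -/

/-- `(d/ds)^m exp(c s) = c^m exp(c s)` for a complex constant `c` and a real variable `s`.
[folklore] -/
theorem iteratedDeriv_cexp_const_mul_ofReal (c : ℂ) :
    ∀ m : ℕ, iteratedDeriv m (fun s : ℝ => Complex.exp (c * (s : ℂ))) =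
      fun s : ℝ => c ^ m * Complex.exp (c * (s : ℂ))
  | 0 => by funext s; simp
  | m + 1 => by
    rw [iteratedDeriv_succ, iteratedDeriv_cexp_const_mul_ofReal c m]
    funext s
    have h1 : HasDerivAt (fun s : ℝ => c * (s : ℂ)) (c * 1) s :=
      ((hasDerivAt_id s).ofReal_comp).const_mul c
    have h2 : HasDerivAt (fun s : ℝ => Complex.exp (c * (s : ℂ))) (Complex.exp (c * (s : ℂ)) * (c * 1)) s :=
      h1.cexp
    have h3 : HasDerivAt (fun s : ℝ => c ^ m * Complex.exp (c * (s : ℂ)))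
        (c ^ m * (Complex.exp (c * (s : ℂ)) * (c * 1))) s := h2.const_mul _
    rw [h3.deriv]
    ring

section Bound

variable [MeasurableSpace (GL (Fin n) (AdeleRing (𝓞 K) K))] [BorelSpace (GL (Fin n) (AdeleRing (𝓞 K) K))]

/-- **The scalar identity `(−2πi Tr b_{k-1,k})^m · W_φ(g) = W_{X'^m φ}(g)`**: differentiate
`W_φ(g · (exp(sX'), 1)) = exp(−2πi s Tr(b_{k-1,k})) W_φ(g)` `m` times at `s = 0`, the left-hand side
under the integrals of the tower (`iteratedDeriv_whittakerDepth_flow`). Moeglin–Waldspurger (1995),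
I.2.10 ("via integration by parts"). [cite: MoeglinWaldspurger1995, I.2.10] -/
theorem pow_mul_whittakerDepth_zero_eq {φ : GL (Fin n) (AdeleRing (𝓞 K) K) → ℂ}
    (hφK : ∀ (γ₀ : GL (Fin n) K) (x : GL (Fin n) (AdeleRing (𝓞 K) K)),
      φ (Matrix.GeneralLinearGroup.map (algebraMap K (AdeleRing (𝓞 K) K)) γ₀ * x) = φ x)
    (hs : ∀ l : List (archGroupGL n K).lie, IsArchSmooth (glArch n K) (iterLieDeriv (glArch n K) l φ))
    (hc : ∀ l : List (archGroupGL n K).lie, Continuous (iterLieDeriv (glArch n K) l φ))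
    (hk0 : 0 < k) (hkn : k < n) (g : GL (Fin n) (AdeleRing (𝓞 K) K)) (b : ArchBlockSpace n k K) (m : ℕ) :
    ((((-(2 * π * mixedTrace K
        (b ⟨((⟨k - 1, by omega⟩ : Fin n), (⟨k, hkn⟩ : Fin n)), superdiag_mem_blockPos hk0 hkn⟩))) : ℝ) : ℂ) *
          Complex.I) ^ m * whittakerDepth 0 φ g =
      whittakerDepth 0 (iterLieDeriv (glArch n K) (List.replicate m (lieOf (twistedBlockDir n k K g b))) φ) g := by
  have hι : Continuous (glArch n K) :=
    (AutomorphyDatum.gl n K (isCompact_glFiniteIntegralLevel_holds n K)).continuous_ofArch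
  rw [← iteratedDeriv_whittakerDepth_flow (glArch n K) hι hs hc 0 (lieOf (twistedBlockDir n k K g b)) g m]
  set c : ℂ := (((-(2 * π * mixedTrace K
        (b ⟨((⟨k - 1, by omega⟩ : Fin n), (⟨k, hkn⟩ : Fin n)), superdiag_mem_blockPos hk0 hkn⟩))) : ℝ) : ℂ) *
          Complex.I with hcdef
  have hfun : (fun s : ℝ => whittakerDepth 0 φ (g * glArch n K ((archGroupGL n K).expMem
      (s • lieOf (twistedBlockDir n k K g b))))) =
      fun s : ℝ => Complex.exp (c * (s : ℂ)) * whittakerDepth 0 φ g := by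
    funext s
    rw [whittakerDepth_zero_mul_expMem_twistedBlockDir_eq_exp hφK hk0 hkn g b s]
    congr 2
    rw [hcdef]
    ring
  rw [hfun, iteratedDeriv_mul_const_field, iteratedDeriv_cexp_const_mul_ofReal c m]
  simp

/-- **The basic inequality**: `‖W_φ(g)‖ · (2π |Tr(b_{k-1,k})|)^m ≤ M` whenever `‖(X'^m φ)(z)‖ ≤ M` for
every `z`, `X' = twistedBlockDir g b` (from the scalar identity and `‖W_{X'^m φ}‖_∞ ≤ ‖X'^m φ‖_∞`,
`norm_whittakerDepth_le`). This is the estimate "`|λ|^h |W| ≤ sup |δ(X'^h) φ|`" of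
Moeglin–Waldspurger (1995), I.2.10–I.2.11, specialised to the Whittaker function; the convergence
"since `φ` is smooth" of Cogdell (2004), Thm. 1.1. [cite: MoeglinWaldspurger1995, I.2.10] -/
theorem norm_whittakerDepth_zero_mul_pow_le {φ : GL (Fin n) (AdeleRing (𝓞 K) K) → ℂ}
    (hφK : ∀ (γ₀ : GL (Fin n) K) (x : GL (Fin n) (AdeleRing (𝓞 K) K)),
      φ (Matrix.GeneralLinearGroup.map (algebraMap K (AdeleRing (𝓞 K) K)) γ₀ * x) = φ x)
    (hs : ∀ l : List (archGroupGL n K).lie, IsArchSmooth (glArch n K) (iterLieDeriv (glArch n K) l φ))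
    (hc : ∀ l : List (archGroupGL n K).lie, Continuous (iterLieDeriv (glArch n K) l φ))
    (hk0 : 0 < k) (hkn : k < n) (g : GL (Fin n) (AdeleRing (𝓞 K) K)) (b : ArchBlockSpace n k K) (m : ℕ)
    {M : ℝ} (hM : ∀ z, ‖iterLieDeriv (glArch n K) (List.replicate m (lieOf (twistedBlockDir n k K g b))) φ z‖ ≤ M) :
    ‖whittakerDepth 0 φ g‖ * (2 * π * |mixedTrace K
        (b ⟨((⟨k - 1, by omega⟩ : Fin n), (⟨k, hkn⟩ : Fin n)), superdiag_mem_blockPos hk0 hkn⟩)|) ^ m ≤ M := by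
  have h := pow_mul_whittakerDepth_zero_eq hφK hs hc hk0 hkn g b m
  have hnorm := congrArg (fun z : ℂ => ‖z‖) h
  simp only [norm_mul, norm_pow, Complex.norm_I, mul_one, Complex.norm_real, Real.norm_eq_abs, abs_neg]
    at hnorm
  rw [abs_mul, abs_of_pos (by positivity : (0 : ℝ) < 2 * π)] at hnorm
  rw [mul_comm, hnorm]
  exact norm_whittakerDepth_le hM 0 g

end Bound

end Literature.NumberTheory.Automorphic
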